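import Literature.AlgebraicTopology.Homotopy.RelativeHomotopyGroups
import HarnessLib

/-!
# Pushing relative loops down a collar: `πₙ(Y, C) ≅ πₙ(Y, D)` when `D` deformation retracts onto `C`

Topic `Literature/AlgebraicTopology/Homotopy`. The vertical isomorphisms of the commutative square
in the proof of the homotopy excision theorem, Hatcher, *Algebraic Topology* (2002), §4.2, proof of
Thm. 4.23 Case 1 (p. 362): `πᵢ(A, C) ≈ πᵢ(X - Q, X - Q - P)` and `πᵢ(X, B) ≈ πᵢ(X, X - P)`, which
hold because the larger subspace deformation retracts onto the smaller one. At the level of the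
tree's relative loops (`RelGenLoop s C a`, maps of triples `(Iᴺ, ∂Iᴺ, J) → (Y, C, a)`,
`RelativeHomotopyGroups.lean`), for subspaces `C ⊆ D ⊆ Y` and a deformation `ρₜ` of `D` into
itself with `ρ₀ = id`, `ρ₁(D) ⊆ C` and `ρₜ = id` on `C` (Hatcher, Ch. 0, p. 2: deformation
retraction in the weak sense), this file PROVES:

* `RelGenLoop.exists_homotopic_widen` — every relative loop of `(Y, D, a)` is homotopic, through
  relative loops of `(Y, D, a)`, to (the widening of) a relative loop of `(Y, C, a)`: append below
  the floor of the cube the collar `(y, σ) ↦ ρ_σ(f(y, 0))` and rescale ("surjectivity" of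
  `πₙ(Y, C, a) → πₙ(Y, D, a)`);
* `RelGenLoop.homotopic_of_homotopic_widen` — two relative loops of `(Y, C, a)` which are homotopic
  through relative loops of `(Y, D, a)` are homotopic through relative loops of `(Y, C, a)`: push
  the whole homotopy down the collar ("injectivity").

The deformation is a plain function `ρ : I × Y → Y`, asked to be continuous on `I × D` only.
Everything is proved; no named facts.

## References

* A. Hatcher, *Algebraic Topology*, CUP (2002), Ch. 0 p. 2 (deformation retractions), §4.2, proof
  of Thm. 4.23, the commutative square on p. 362. [HatcherAT2002]
-/

noncomputable section

open Set Function Topology unitInterval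
open scoped Topology Topology.Homotopy

namespace Literature.AlgebraicTopology.Homotopy

namespace RelGenLoop

variable {N : Type*} {Y : Type*} [TopologicalSpace Y]
variable {s : N} {C D : Set Y}

/-! ### Widening the subspace -/

/-- A relative loop of `(Y, C, a)` is a relative loop of `(Y, D, a)` for `C ⊆ D` (same map).
[folklore] -/
def widen (hCD : C ⊆ D) {a : C} (f : RelGenLoop s C a) : RelGenLoop s D ⟨a, hCD a.2⟩ :=
  ⟨f.1, fun _ hy => hCD (apply_mem f hy), fun _ hy => apply_of_mem_jBoundary f hy⟩

/-- Widening does not change the map. [folklore] -/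
@[simp]
theorem widen_apply (hCD : C ⊆ D) {a : C} (f : RelGenLoop s C a) (y : I^N) : widen hCD f y = f y := rfl

/-- Widening preserves homotopy of relative loops. [folklore] -/
theorem homotopic_widen (hCD : C ⊆ D) {a : C} {f g : RelGenLoop s C a} (h : Homotopic f g) :
    Homotopic (widen hCD f) (widen hCD g) := by
  obtain ⟨H⟩ := h
  exact ⟨{ toFun := H
           continuous_toFun := H.continuous
           map_zero_left := fun y => H.apply_zero y
           map_one_left := fun y => H.apply_one y
           prop' := fun t => ⟨fun y hy => hCD ((H.prop' t).1 y hy), fun y hy => (H.prop' t).2 y hy⟩ }⟩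

/-! ### The push down the collar -/

section Push

variable (s)

/-- Rescaling of the upper part `λ/2 ≤ yₛ ≤ 1` of the segment onto `[0, 1]`. [folklore] -/
def collarUp (lam : I) (y : I^N) : I :=
  Set.projIcc 0 1 zero_le_one (((y s : ℝ) - (lam : ℝ) / 2) / (1 - (lam : ℝ) / 2))

/-- Collar parameter `λ - 2yₛ` on the lower part `0 ≤ yₛ ≤ λ/2`. [folklore] -/
def collarDown (lam : I) (y : I^N) : I :=
  Set.projIcc 0 1 zero_le_one ((lam : ℝ) - 2 * (y s : ℝ))

variable {s}

/-- `collarUp` is jointly continuous. [folklore] -/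
theorem continuous_collarUp : Continuous fun p : I × (I^N) => collarUp s p.1 p.2 := by
  unfold collarUp
  refine continuous_projIcc.comp ?_
  have h1 : Continuous fun p : I × (I^N) => ((p.1 : I) : ℝ) := continuous_subtype_val.comp continuous_fst
  have h2 : Continuous fun p : I × (I^N) => ((p.2 s : I) : ℝ) :=
    continuous_subtype_val.comp ((continuous_apply s).comp continuous_snd)
  refine (h2.sub (h1.div_const 2)).div (continuous_const.sub (h1.div_const 2)) fun p => ?_
  have := p.1.2.2
  intro h
  have : ((p.1 : I) : ℝ) = 2 := by linarith
  linarith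

/-- `collarDown` is jointly continuous. [folklore] -/
theorem continuous_collarDown : Continuous fun p : I × (I^N) => collarDown s p.1 p.2 := by
  unfold collarDown
  refine continuous_projIcc.comp ?_
  exact (continuous_subtype_val.comp continuous_fst).sub
    (continuous_const.mul (continuous_subtype_val.comp ((continuous_apply s).comp continuous_snd)))

/-- At `yₛ = λ/2` the rescaled coordinate is `0`. [folklore] -/
theorem collarUp_of_eq {lam : I} {y : I^N} (h : (lam : ℝ) = 2 * (y s : ℝ)) : collarUp s lam y = 0 := by
  unfold collarUp
  have : ((y s : ℝ) - (lam : ℝ) / 2) / (1 - (lam : ℝ) / 2) = 0 := by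
    rw [div_eq_zero_iff]; left; linarith
  rw [this]
  ext; simp

/-- At `yₛ = λ/2` the collar parameter is `0`. [folklore] -/
theorem collarDown_of_eq {lam : I} {y : I^N} (h : (lam : ℝ) = 2 * (y s : ℝ)) : collarDown s lam y = 0 := by
  unfold collarDown
  rw [show (lam : ℝ) - 2 * (y s : ℝ) = 0 by linarith]
  ext; simp

/-- At `λ = 0` the rescaling is the identity. [folklore] -/
theorem collarUp_zero (y : I^N) : collarUp s 0 y = y s := by
  unfold collarUp
  simp only [Set.Icc.coe_zero, zero_div, sub_zero, div_one]
  exact Set.projIcc_val zero_le_one (y s)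

/-- On the top face the rescaled coordinate is `1`. [folklore] -/
theorem collarUp_of_top {lam : I} {y : I^N} (hy : y s = 1) : collarUp s lam y = 1 := by
  unfold collarUp
  rw [hy]
  have hne : (1 : ℝ) - (lam : ℝ) / 2 ≠ 0 := by
    have := lam.2.2; intro h; linarith
  rw [Set.Icc.coe_one, div_self hne]
  ext; simp

/-- On the floor the collar parameter is `λ`. [folklore] -/
theorem collarDown_of_floor {lam : I} {y : I^N} (hy : y s = 0) : collarDown s lam y = lam := by
  unfold collarDown
  rw [hy]
  simp only [Set.Icc.coe_zero, mul_zero, sub_zero]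
  exact Set.projIcc_val zero_le_one lam

variable [DecidableEq N]

variable (s) in
/-- **The push of a map of the cube down the collar** at stage `λ`: on `yₛ ≥ λ/2` the map itself,
rescaled; on `yₛ ≤ λ/2` the collar `ρ_{λ - 2yₛ}` applied to the floor values (Hatcher 2002,
p. 362, the vertical isomorphisms). [cite: HatcherAT2002, §4.2 p. 362] -/
def push (ρ : I × Y → Y) (lam : I) (u : (I^N) → Y) (y : I^N) : Y :=
  if (lam : ℝ) ≤ 2 * (y s : ℝ) then u (update y s (collarUp s lam y))
  else ρ (collarDown s lam y, u (update y s 0))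

variable {ρ : I × Y → Y}

/-- **Joint continuity of the push** along a continuous family of maps `U_τ` and stages `Λ τ`,
provided the floor values of each `U_τ` lie in `D` (where `ρ` is continuous) and `ρ₀ = id` on `D`
(so that the two formulas agree at `yₛ = λ/2`). [folklore] -/
theorem continuous_push {T : Type*} [TopologicalSpace T]
    (hρc : ContinuousOn ρ {p | p.2 ∈ D}) (hρ0 : ∀ x, x ∈ D → ρ (0, x) = x)
    {U : T × (I^N) → Y} (hU : Continuous U) {Λ : T → I} (hΛ : Continuous Λ)
    (hUD : ∀ τ y, y s = 0 → U (τ, y) ∈ D) :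
    Continuous fun p : T × (I^N) => push s ρ (Λ p.1) (fun y => U (p.1, y)) p.2 := by
  unfold push
  have hA : Continuous fun p : T × (I^N) => U (p.1, update p.2 s (collarUp s (Λ p.1) p.2)) :=
    hU.comp (continuous_fst.prodMk (continuous_snd.update s
      (continuous_collarUp.comp ((hΛ.comp continuous_fst).prodMk continuous_snd))))
  have hfloor : Continuous fun p : T × (I^N) => U (p.1, update p.2 s 0) :=
    hU.comp (continuous_fst.prodMk (continuous_snd.update s continuous_const))
  have hB : Continuous fun p : T × (I^N) => ρ (collarDown s (Λ p.1) p.2, U (p.1, update p.2 s 0)) := by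
    refine hρc.comp_continuous ((continuous_collarDown.comp ((hΛ.comp continuous_fst).prodMk
      continuous_snd)).prodMk hfloor) fun p => ?_
    exact hUD p.1 _ (by simp)
  refine Continuous.if_le hA hB (continuous_subtype_val.comp (hΛ.comp continuous_fst))
    (continuous_const.mul (continuous_subtype_val.comp ((continuous_apply s).comp continuous_snd)))
    fun p hp => ?_
  rw [collarUp_of_eq hp, collarDown_of_eq hp, hρ0 _ (hUD p.1 _ (by simp))]


/-- Continuity of the push of a single map at a fixed stage. [folklore] -/
theorem continuous_push_single (hρc : ContinuousOn ρ {p | p.2 ∈ D}) (hρ0 : ∀ x, x ∈ D → ρ (0, x) = x)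
    {u : (I^N) → Y} (hu : Continuous u) (huD : ∀ y : I^N, y s = 0 → u y ∈ D) (lam : I) :
    Continuous (push s ρ lam u) := by
  have h := continuous_push (T := Unit) (s := s) hρc hρ0 (U := fun p => u p.2)
    (hu.comp continuous_snd) (Λ := fun _ => lam) continuous_const (fun _ y hy => huD y hy)
  exact h.comp ((continuous_const (y := ())).prodMk continuous_id)

omit [TopologicalSpace Y] in
/-- At stage `λ = 0` the push is the map itself. [folklore] -/
theorem push_zero (u : (I^N) → Y) (y : I^N) : push s ρ 0 u y = u y := by
  unfold push
  have h : ((0 : I) : ℝ) ≤ 2 * (y s : ℝ) := by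
    rw [Set.Icc.coe_zero]; exact mul_nonneg zero_le_two (y s).2.1
  rw [if_pos h, collarUp_zero, update_eq_self]

omit [TopologicalSpace Y] in
/-- **Face behaviour of the push.** If the floor values of `u` lie in `D` and `u` is the constant
`a ∈ C` on `J`, then at every stage the push has floor values in `D`, is `a` on `J`, has floor
values in `C` at stage `1`, and keeps its floor values in `C` if they already were (then the push
does not change the floor values at all). [folklore] -/
theorem push_faces (hρD : ∀ t x, x ∈ D → ρ (t, x) ∈ D)
    (hρ1 : ∀ x, x ∈ D → ρ (1, x) ∈ C) (hρC : ∀ t x, x ∈ C → ρ (t, x) = x)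
    {a : Y} (ha : a ∈ C) {u : (I^N) → Y}
    (hu0 : ∀ y : I^N, y s = 0 → u y ∈ D) (huJ : ∀ y ∈ jBoundary s, u y = a) (lam : I) :
    (∀ y : I^N, y s = 0 → push s ρ lam u y ∈ D) ∧
    (∀ y ∈ jBoundary s, push s ρ lam u y = a) ∧
    (lam = 1 → ∀ y : I^N, y s = 0 → push s ρ lam u y ∈ C) ∧
    ((∀ y : I^N, y s = 0 → u y ∈ C) → ∀ y : I^N, y s = 0 → push s ρ lam u y = u y) := by
  refine ⟨fun y hy => ?_, fun y hy => ?_, fun hlam y hy => ?_, fun huC y hy => ?_⟩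
  · unfold push
    split_ifs with h
    · -- then `λ = 0` and the point is `y` itself
      have hlam0 : (lam : ℝ) = 2 * (y s : ℝ) := le_antisymm h (by rw [hy]; simp [lam.2.1])
      rw [collarUp_of_eq hlam0]
      exact hu0 _ (by simp)
    · exact hρD _ _ (hu0 _ (by simp))
  · unfold push
    rcases (mem_jBoundary).1 hy with htop | ⟨j, hj, hj'⟩
    · -- top face
      have h : (lam : ℝ) ≤ 2 * (y s : ℝ) := by rw [htop]; have := lam.2.2; simp; linarith
      rw [if_pos h, collarUp_of_top htop]
      have : update y s 1 = y := by rw [← htop, update_eq_self]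
      rw [this]
      exact huJ y hy
    · -- a wall: both formulas give `a`
      have hw : ∀ t : I, update y s t ∈ jBoundary s := fun t =>
        (mem_jBoundary).2 (Or.inr ⟨j, hj, by simpa [hj] using hj'⟩)
      split_ifs with h
      · exact huJ _ (hw _)
      · rw [huJ _ (hw 0)]
        exact hρC _ _ ha
  · subst hlam
    unfold push
    have h : ¬ ((1 : I) : ℝ) ≤ 2 * (y s : ℝ) := by rw [hy]; simp
    rw [if_neg h, collarDown_of_floor hy]
    exact hρ1 _ (hu0 _ (by simp))
  · unfold push
    have hupd : update y s 0 = y := by rw [← hy, update_eq_self]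
    split_ifs with h
    · have hlam0 : (lam : ℝ) = 2 * (y s : ℝ) := le_antisymm h (by rw [hy]; simp [lam.2.1])
      rw [collarUp_of_eq hlam0, hupd]
    · rw [hupd]
      exact hρC _ _ (huC y hy)

end Push

/-! ### The two collar lemmas -/

section Collar

variable [DecidableEq N] (s) {ρ : I × Y → Y}

/-- The push at stage `1` of a relative loop of `(Y, D, a)`, as a relative loop of `(Y, C, a)`.
[cite: HatcherAT2002, §4.2 p. 362] -/
def pushLoop (hρc : ContinuousOn ρ {p | p.2 ∈ D}) (hρD : ∀ t x, x ∈ D → ρ (t, x) ∈ D)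
    (hρ0 : ∀ x, x ∈ D → ρ (0, x) = x) (hρ1 : ∀ x, x ∈ D → ρ (1, x) ∈ C)
    (hρC : ∀ t x, x ∈ C → ρ (t, x) = x) (hCD : C ⊆ D) (a : C)
    (f : RelGenLoop s D ⟨a, hCD a.2⟩) : RelGenLoop s C a :=
  ⟨⟨push s ρ 1 f, continuous_push_single hρc hρ0 f.1.continuous (fun _ hy => apply_mem f hy) 1⟩,
    (push_faces hρD hρ1 hρC a.2 (fun _ hy => apply_mem f hy)
      (fun _ hy => apply_of_mem_jBoundary f hy) 1).2.2.1 rfl,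
    (push_faces hρD hρ1 hρC a.2 (fun _ hy => apply_mem f hy)
      (fun _ hy => apply_of_mem_jBoundary f hy) 1).2.1⟩

/-- The pushed loop on points. [folklore] -/
@[simp]
theorem pushLoop_apply (hρc : ContinuousOn ρ {p | p.2 ∈ D}) (hρD : ∀ t x, x ∈ D → ρ (t, x) ∈ D)
    (hρ0 : ∀ x, x ∈ D → ρ (0, x) = x) (hρ1 : ∀ x, x ∈ D → ρ (1, x) ∈ C)
    (hρC : ∀ t x, x ∈ C → ρ (t, x) = x) (hCD : C ⊆ D) (a : C)
    (f : RelGenLoop s D ⟨a, hCD a.2⟩) (y : I^N) :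
    pushLoop s hρc hρD hρ0 hρ1 hρC hCD a f y = push s ρ 1 f y := rfl

/-- **The stage homotopy**: a relative loop `f` of `(Y, D, a)` is homotopic through relative loops
of `(Y, D, a)` to its push at stage `1`; if the floor values of `f` lie in `C` the homotopy runs
through relative loops of `(Y, C, a)`. [cite: HatcherAT2002, §4.2 p. 362] -/
theorem homotopicWith_push (hρc : ContinuousOn ρ {p | p.2 ∈ D}) (hρD : ∀ t x, x ∈ D → ρ (t, x) ∈ D)
    (hρ0 : ∀ x, x ∈ D → ρ (0, x) = x) (hρ1 : ∀ x, x ∈ D → ρ (1, x) ∈ C)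
    (hρC : ∀ t x, x ∈ C → ρ (t, x) = x) (hCD : C ⊆ D) (a : C)
    (f : RelGenLoop s D ⟨a, hCD a.2⟩) (E : Set Y) (hE : E = D ∨ (E = C ∧ ∀ y : I^N, y s = 0 → f y ∈ C)) :
    (f : C(I^N, Y)).HomotopicWith (pushLoop s hρc hρD hρ0 hρ1 hρC hCD a f : C(I^N, Y))
      (· ∈ RelGenLoop s E (⟨a, by rcases hE with rfl | ⟨rfl, -⟩; exacts [hCD a.2, a.2]⟩ : E)) := by
  have hcont := continuous_push (T := I) (s := s) hρc hρ0 (U := fun p => f p.2)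
    (f.1.continuous.comp continuous_snd) (Λ := id) continuous_id (fun _ y hy => apply_mem f hy)
  refine ⟨{ toFun := fun p => push s ρ p.1 f p.2
            continuous_toFun := hcont
            map_zero_left := fun y => push_zero (ρ := ρ) f y
            map_one_left := fun y => rfl
            prop' := fun t => ?_ }⟩
  have hf := push_faces (s := s) hρD hρ1 hρC a.2 (fun _ hy => apply_mem f hy)
    (fun _ hy => apply_of_mem_jBoundary f hy) t
  refine ⟨fun y hy => ?_, fun y hy => hf.2.1 y hy⟩
  show push s ρ t f y ∈ E
  rcases hE with rfl | ⟨rfl, hfC⟩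
  · exact hf.1 y hy
  · rw [hf.2.2.2 hfC y hy]
    exact hfC y hy

/-- **Collar lemma, surjectivity form** (Hatcher 2002, p. 362: the vertical isomorphisms of the
excision square): if `D ⊇ C` deforms into itself onto `C` keeping `C` fixed, every relative loop
of `(Y, D, a)` is homotopic through relative loops of `(Y, D, a)` to a relative loop of `(Y, C, a)`.
[cite: HatcherAT2002, §4.2, proof of Thm. 4.23 (p. 362)] -/
theorem exists_homotopic_widen (hρc : ContinuousOn ρ {p | p.2 ∈ D})
    (hρD : ∀ t x, x ∈ D → ρ (t, x) ∈ D) (hρ0 : ∀ x, x ∈ D → ρ (0, x) = x)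
    (hρ1 : ∀ x, x ∈ D → ρ (1, x) ∈ C) (hρC : ∀ t x, x ∈ C → ρ (t, x) = x) (hCD : C ⊆ D) (a : C)
    (f : RelGenLoop s D ⟨a, hCD a.2⟩) :
    ∃ g : RelGenLoop s C a, Homotopic f (widen hCD g) := by
  refine ⟨pushLoop s hρc hρD hρ0 hρ1 hρC hCD a f, ?_⟩
  have h := homotopicWith_push s hρc hρD hρ0 hρ1 hρC hCD a f D (Or.inl rfl)
  exact h

/-- **Collar lemma, injectivity form** (Hatcher 2002, p. 362): if `D ⊇ C` deforms into itself
onto `C` keeping `C` fixed, two relative loops of `(Y, C, a)` that are homotopic through relative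
loops of `(Y, D, a)` are homotopic through relative loops of `(Y, C, a)`.
[cite: HatcherAT2002, §4.2, proof of Thm. 4.23 (p. 362)] -/
theorem homotopic_of_homotopic_widen (hρc : ContinuousOn ρ {p | p.2 ∈ D})
    (hρD : ∀ t x, x ∈ D → ρ (t, x) ∈ D) (hρ0 : ∀ x, x ∈ D → ρ (0, x) = x)
    (hρ1 : ∀ x, x ∈ D → ρ (1, x) ∈ C) (hρC : ∀ t x, x ∈ C → ρ (t, x) = x) (hCD : C ⊆ D) (a : C)
    {f₀ f₁ : RelGenLoop s C a} (h : Homotopic (widen hCD f₀) (widen hCD f₁)) : Homotopic f₀ f₁ := by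
  -- `fᵢ ≃ push 1 fᵢ` through `C`-loops
  have hstage : ∀ f : RelGenLoop s C a,
      Homotopic f (pushLoop s hρc hρD hρ0 hρ1 hρC hCD a (widen hCD f)) := fun f =>
    homotopicWith_push s hρc hρD hρ0 hρ1 hρC hCD a (widen hCD f) C
      (Or.inr ⟨rfl, fun y hy => apply_mem f hy⟩)
  -- push the `D`-homotopy down the collar
  obtain ⟨H⟩ := h
  have hcont := continuous_push (T := I) (s := s) hρc hρ0 (U := fun p => H p) H.continuous
    (Λ := fun _ => 1) continuous_const (fun t y hy => (H.prop' t).1 y hy)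
  have hmid : Homotopic (pushLoop s hρc hρD hρ0 hρ1 hρC hCD a (widen hCD f₀))
      (pushLoop s hρc hρD hρ0 hρ1 hρC hCD a (widen hCD f₁)) := by
    refine ⟨{ toFun := fun p => push s ρ 1 (fun y => H (p.1, y)) p.2
              continuous_toFun := hcont
              map_zero_left := fun y => ?_
              map_one_left := fun y => ?_
              prop' := fun t => ?_ }⟩
    · show push s ρ 1 (fun y => H (0, y)) y = push s ρ 1 (widen hCD f₀) y
      congr 1; ext y'; exact H.apply_zero y'
    · show push s ρ 1 (fun y => H (1, y)) y = push s ρ 1 (widen hCD f₁) y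
      congr 1; ext y'; exact H.apply_one y'
    · have hf := push_faces (s := s) hρD hρ1 hρC a.2 (u := fun y => H (t, y))
        (fun y hy => (H.prop' t).1 y hy) (fun y hy => (H.prop' t).2 y hy) 1
      exact ⟨fun y hy => hf.2.2.1 rfl y hy, fun y hy => hf.2.1 y hy⟩
  exact ((hstage f₀).trans hmid).trans (hstage f₁).symm

end Collar

end RelGenLoop

end Literature.AlgebraicTopology.Homotopy
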